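import Summits.Ventures.CertifiedManyBodySolver.Rows.CorrWindowCertDictionaries
import Literature.MathematicalPhysics.QuantumLattice.HubbardFermionInteractionTerms
import HarnessLib

/-!
# DICTIONARIES for the kernel form of the window-certificate soundness (2): the embedded MEAN-ENERGY OBSERVABLE
# `Γ(incl) E^{t,t',U}_Φ ∈ 𝔄_{Λ'}` as a syntactic term list over indexed site letters (`termOp_energyTermsIdx`)

HONEST FRAMING: Lean plumbing towards «tier P» (no claim node discharged, no number); the rows this serves are CONTROL/CALIBRATION
stiffness-scale CEILINGS (wording (xx1)), silent on the presence of superconductivity; not a `T_c` or phase sentence; no summit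
statement is proved by this file. Seat hubbard-obs-p2 (STIFFNESS), `prover-hubbard-obs-p2-g22-0`, zero compute.

Companion of `Rows/CorrWindowCertDictionaries.lean` (the window Hamiltonian). Here: the SECOND dictionary hypothesis of
`Rows/CorrWindowCertKernelForm.lean`, `termOp d TE = fermionEmbed (PolySite.incl h0) ((hubbardTTPrimeFermionInteraction t tp U).meanEnergyObs 1)`,
discharged for every window containing the `3 × 3` block around the origin: with an index reader `ix : Site 2 → Fin N` correct on
`thicken {0} 1` (`xs (ix v) = v` there), the computable list `energyTermsIdx t tp U ix` — `U a†_{0↑}a_{0↑}a†_{0↓}a_{0↓}` plus ONE HALF of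
each of the four nearest-neighbour bonds and of the four diagonal bonds through the origin (both orientations, `−t/2`, `−tp/2`) —
denotes `Γ(incl) E_Φ` (the tree's closed forms `hubbardFermionInteraction_meanEnergyObs`, `diagHoppingFermionInteraction_meanEnergyObs`,
`…_apply_singleton`, `…_apply_pair`). Everything is PROVED (0 sorry).

References: O. Bratteli, A. Kishimoto, D. W. Robinson, CMP 64 (1978) 41, §3 (mean energy functional) [BratteliKishimotoRobinson1978];
H. Xu et al., Science 384 (2024) eadh7691, eq. (1) [XuEtAl2024].
-/

noncomputable section

namespace Summit.Ventures.CertifiedManyBodySolver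

namespace CARPolyWindow

open Summit.Ventures.CertifiedQuantumChemistry Summit.Ventures.CertifiedQuantumChemistry.CARPoly
open Literature.MathematicalPhysics.QuantumLattice Literature.MathematicalPhysics.QuantumLattice.HubbardWave0
open Literature.Probability.LatticeModels
open Matrix Finset
open scoped ComplexOrder BigOperators

/-! ## The syntactic mean-energy observable -/

section Syntax

variable {N : ℕ}

/-- A symmetric bond list `Σ_σ c (a†_{iσ} a_{jσ} + a†_{jσ} a_{iσ})`. [cite: XuEtAl2024, eq. (1)] -/
def bondT (i j : Fin N) (c : ℚ) : Terms (Orb (Fin N)) := hopT i j c ++ hopT j i c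

/-- **The embedded mean-energy observable `Γ(incl) E^{t,tp,U}_Φ` as a term list** (index reader `ix : ℤ² → Fin N`):
`U n_{0↑}n_{0↓} + Σ_i (−t/2)(bond(0, 0+eᵢ) + bond(−eᵢ, −eᵢ+eᵢ)) + Σ_s (−tp/2)(bond(0, 0+j_s) + bond(−j_s, −j_s+j_s))` — the on-site term at
the origin and one half of every bond through the origin (the site expressions are kept in the shape of the tree's closed forms).
[cite: BratteliKishimotoRobinson1978, §3 (mean energy functional)] -/
def energyTermsIdx (t tp U : ℚ) (ix : Site 2 → Fin N) : Terms (Orb (Fin N)) :=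
  [([(orb (ix 0) 0, true), (orb (ix 0) 0, false), (orb (ix 0) 1, true), (orb (ix 0) 1, false)], U)] ++
    ((finL 2).flatMap fun i : Fin 2 =>
      bondT (ix 0) (ix (0 + unitVec i)) (-t / 2) ++ bondT (ix (-unitVec i)) (ix (-unitVec i + unitVec i)) (-t / 2)) ++
    ((finL 2).flatMap fun s : Fin 2 =>
      bondT (ix 0) (ix (0 + diagVec s)) (-tp / 2) ++ bondT (ix (-diagVec s)) (ix (-diagVec s + diagVec s)) (-tp / 2))

end Syntax

/-! ## The dictionary theorem -/

section Dictionary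

variable {N : ℕ} {Λ' : Finset (Site 2)}

/-- Membership-proof irrelevance for ordered sites. [folklore] -/
private theorem pt_congr_site {x y : Site 2} (hx : x ∈ Λ') (hy : y ∈ Λ') (h : x = y) :
    PolySite.pt x hx = PolySite.pt y hy := by
  subst h; rfl

/-- A symmetric bond list denotes `c • Σ_σ (a†_{iσ} a_{jσ} + a†_{jσ} a_{iσ})`. [cite: XuEtAl2024, eq. (1)] -/
theorem termOp_bondT (xs : Fin N → Site 2) (hmem : ∀ i, xs i ∈ Λ') (d : Orb (Fin N) → Orb (PolySite Λ'))
    (hd : ∀ i σ, d (orb i σ) = orb (PolySite.pt (xs i) (hmem i)) σ) (i j : Fin N) (c : ℚ) :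
    termOp d (bondT i j c) = ((c : ℚ) : ℂ) • ∑ σ : Fin 2,
      (creation (orb (PolySite.pt (xs i) (hmem i)) σ) * annihilation (orb (PolySite.pt (xs j) (hmem j)) σ) +
        creation (orb (PolySite.pt (xs j) (hmem j)) σ) * annihilation (orb (PolySite.pt (xs i) (hmem i)) σ)) := by
  rw [bondT, termOp_append, termOp_hopT xs hmem d hd, termOp_hopT xs hmem d hd, Finset.smul_sum, ← Finset.sum_add_distrib]
  refine Finset.sum_congr rfl fun σ _ => ?_
  rw [smul_add]

/-- One embedded bond term of the tree's closed form, in creation/annihilation form: for `{x, y} ⊆ thicken {0} 1`,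
`Γ(incl h0)(Γ(incl hxy)(−c Σ_σ (c†_x c_y + c†_y c_x))) = −c Σ_σ (…)` in `𝔄_{Λ'}`. [cite: BratteliRobinsonII1997, §5.2.2] -/
private theorem embed_bond {Λ' : Finset (Site 2)} (h0 : thicken ({0} : Finset (Site 2)) 1 ⊆ Λ') {x y : Site 2}
    (hxy : ({x, y} : Finset (Site 2)) ⊆ thicken ({0} : Finset (Site 2)) 1) (c : ℂ) :
    fermionEmbed (PolySite.incl h0) (fermionEmbed (PolySite.incl hxy)
      (-c • ∑ σ : Fin 2, ((cAt x (mem_insert_self _ _) σ)ᴴ * cAt y (mem_insert_of_mem (mem_singleton_self _)) σ +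
        (cAt y (mem_insert_of_mem (mem_singleton_self _)) σ)ᴴ * cAt x (mem_insert_self _ _) σ))) =
      -c • ∑ σ : Fin 2,
        (creation (orb (PolySite.pt x (h0 (hxy (mem_insert_self _ _)))) σ) *
            annihilation (orb (PolySite.pt y (h0 (hxy (mem_insert_of_mem (mem_singleton_self _))))) σ) +
          creation (orb (PolySite.pt y (h0 (hxy (mem_insert_of_mem (mem_singleton_self _))))) σ) *
            annihilation (orb (PolySite.pt x (h0 (hxy (mem_insert_self _ _)))) σ)) := by
  rw [fermionEmbed_fermionEmbed, PolySite.incl_trans, map_smul, map_sum]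
  refine congrArg _ (Finset.sum_congr rfl fun σ _ => ?_)
  rw [map_add, map_mul, map_mul, fermionEmbed_conjTranspose, fermionEmbed_conjTranspose, fermionEmbed_incl_cAt,
    fermionEmbed_incl_cAt, cAt, cAt, annihilation_conjTranspose, annihilation_conjTranspose]

/-- **DICTIONARY: the indexed term list IS the embedded mean-energy observable.** For an enumeration `xs : Fin N → ℤ²` of sites
of `Λ' ⊇ thicken {0} 1`, the letter map `d (i, σ) = (xs i, σ)` and an index reader `ix` with `xs (ix v) = v` on `thicken {0} 1`:
`termOp d (energyTermsIdx t tp U ix) = Γ(incl h0) ((hubbardTTPrimeFermionInteraction t tp U).meanEnergyObs 1)`.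
[cite: BratteliKishimotoRobinson1978, §3 (mean energy functional)] -/
theorem termOp_energyTermsIdx (t tp U : ℚ) (xs : Fin N → Site 2) (hmem : ∀ i, xs i ∈ Λ')
    (h0 : thicken ({0} : Finset (Site 2)) 1 ⊆ Λ') (ix : Site 2 → Fin N)
    (hix : ∀ v ∈ thicken ({0} : Finset (Site 2)) 1, xs (ix v) = v)
    (d : Orb (Fin N) → Orb (PolySite Λ')) (hd : ∀ i σ, d (orb i σ) = orb (PolySite.pt (xs i) (hmem i)) σ) :
    termOp d (energyTermsIdx t tp U ix) =
      fermionEmbed (PolySite.incl h0) ((hubbardTTPrimeFermionInteraction (t : ℝ) (tp : ℝ) (U : ℝ)).meanEnergyObs 1) := by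
  -- abbreviations: the indexed orbitals
  set P : Site 2 → PolySite Λ' := fun v => PolySite.pt (xs (ix v)) (hmem (ix v)) with hP
  -- every site of the 3×3 block, with ANY membership proof, is the indexed one
  have hpt : ∀ (v : Site 2) (hv : v ∈ thicken ({0} : Finset (Site 2)) 1) (hv' : v ∈ Λ'), PolySite.pt v hv' = P v := by
    intro v hv hv'
    exact pt_congr_site hv' (hmem (ix v)) (hix v hv).symm
  have hz : (0 : Site 2) ∈ thicken ({0} : Finset (Site 2)) 1 := zero_mem_thicken_zero 1
  have hu : ∀ i : Fin 2, (0 : Site 2) + unitVec i ∈ thicken ({0} : Finset (Site 2)) 1 := fun i => by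
    rw [zero_add]; exact unitVec_mem_thicken_one i
  have hnu : ∀ i : Fin 2, -unitVec i ∈ thicken ({0} : Finset (Site 2)) 1 := fun i => neg_unitVec_mem_thicken_one i
  have hnuu : ∀ i : Fin 2, -unitVec i + unitVec i ∈ thicken ({0} : Finset (Site 2)) 1 := fun i => by
    rw [neg_add_cancel]; exact hz
  have hdv : ∀ s : Fin 2, (0 : Site 2) + diagVec s ∈ thicken ({0} : Finset (Site 2)) 1 := fun s => by
    rw [zero_add]; exact diagVec_mem_thicken_one s
  have hndv : ∀ s : Fin 2, -diagVec s ∈ thicken ({0} : Finset (Site 2)) 1 := fun s => neg_diagVec_mem_thicken_one s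
  have hndd : ∀ s : Fin 2, -diagVec s + diagVec s ∈ thicken ({0} : Finset (Site 2)) 1 := fun s => by
    rw [neg_add_cancel]; exact hz
  -- (1) the semantic side in creation/annihilation form over the indexed orbitals
  have hsem : fermionEmbed (PolySite.incl h0) ((hubbardTTPrimeFermionInteraction (t : ℝ) (tp : ℝ) (U : ℝ)).meanEnergyObs 1) =
      (((U : ℚ) : ℝ) : ℂ) • (numberOp (P 0) 0 * numberOp (P 0) 1) +
        ∑ i : Fin 2, ((2 : ℂ)⁻¹ • (-(((t : ℚ) : ℝ) : ℂ) • ∑ σ : Fin 2,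
            (creation (orb (P 0) σ) * annihilation (orb (P (0 + unitVec i)) σ) +
              creation (orb (P (0 + unitVec i)) σ) * annihilation (orb (P 0) σ))) +
          (2 : ℂ)⁻¹ • (-(((t : ℚ) : ℝ) : ℂ) • ∑ σ : Fin 2,
            (creation (orb (P (-unitVec i)) σ) * annihilation (orb (P (-unitVec i + unitVec i)) σ) +
              creation (orb (P (-unitVec i + unitVec i)) σ) * annihilation (orb (P (-unitVec i)) σ)))) +
        ∑ s : Fin 2, ((2 : ℂ)⁻¹ • (-(((tp : ℚ) : ℝ) : ℂ) • ∑ σ : Fin 2,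
            (creation (orb (P 0) σ) * annihilation (orb (P (0 + diagVec s)) σ) +
              creation (orb (P (0 + diagVec s)) σ) * annihilation (orb (P 0) σ))) +
          (2 : ℂ)⁻¹ • (-(((tp : ℚ) : ℝ) : ℂ) • ∑ σ : Fin 2,
            (creation (orb (P (-diagVec s)) σ) * annihilation (orb (P (-diagVec s + diagVec s)) σ) +
              creation (orb (P (-diagVec s + diagVec s)) σ) * annihilation (orb (P (-diagVec s)) σ)))) := by
    rw [hubbardTTPrimeFermionInteraction_meanEnergyObs, map_add, hubbardFermionInteraction_meanEnergyObs,
      diagHoppingFermionInteraction_meanEnergyObs, map_add, map_sum, map_sum]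
    congr 1
    congr 1
    · -- on-site term
      rw [fermionEmbed_fermionEmbed, PolySite.incl_trans, hubbardFermionInteraction_apply_singleton, map_smul, map_mul,
        nAt, nAt, fermionEmbed_numberOp, fermionEmbed_numberOp, PolySite.incl_pt, hpt 0 hz]
    · refine Finset.sum_congr rfl fun i _ => ?_
      rw [map_add, map_smul, map_smul, hubbardFermionInteraction_apply_pair, hubbardFermionInteraction_apply_pair,
        embed_bond h0, embed_bond h0, hpt 0 hz, hpt _ (hu i), hpt _ (hnu i), hpt _ (hnuu i)]
    · refine Finset.sum_congr rfl fun s _ => ?_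
      rw [map_add, map_smul, map_smul, diagHoppingFermionInteraction_apply_pair, diagHoppingFermionInteraction_apply_pair,
        embed_bond h0, embed_bond h0, hpt 0 hz, hpt _ (hdv s), hpt _ (hndv s), hpt _ (hndd s)]
  -- (2) the syntactic side
  rw [hsem, energyTermsIdx, termOp_append, termOp_append, termOp_onSite xs hmem d hd, termOp_flatMap_finL,
    termOp_flatMap_finL, Complex.ofReal_ratCast]
  congr 1
  congr 1
  · refine Finset.sum_congr rfl fun i _ => ?_
    rw [termOp_append, termOp_bondT xs hmem d hd, termOp_bondT xs hmem d hd, smul_smul, smul_smul]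
    have ec : (2 : ℂ)⁻¹ * -(((t : ℚ) : ℝ) : ℂ) = (((-t / 2 : ℚ)) : ℂ) := by
      rw [Complex.ofReal_ratCast]; push_cast; ring
    rw [ec]
  · refine Finset.sum_congr rfl fun s _ => ?_
    rw [termOp_append, termOp_bondT xs hmem d hd, termOp_bondT xs hmem d hd, smul_smul, smul_smul]
    have ec : (2 : ℂ)⁻¹ * -(((tp : ℚ) : ℝ) : ℂ) = (((-tp / 2 : ℚ)) : ℂ) := by
      rw [Complex.ofReal_ratCast]; push_cast; ring
    rw [ec]

end Dictionary

end CARPolyWindow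

end Summit.Ventures.CertifiedManyBodySolver

end
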